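import Summits.BirchSwinnertonDyer.BirchSwinnertonDyer.Theorems.GenusKolyvaginAtTwoGenusPrimitiveSupplyAtTwoLoweringStep
import Summits.BirchSwinnertonDyer.BirchSwinnertonDyer.Theorems.GenusKolyvaginAtTwoGenusPrimitiveSupplyAtTwoLoweringPrimeNoTwoTorsion
import Literature.NumberTheory.EllipticCurves.TwistFamilySelmerGroupCardInvarianceProofs
import Literature.NumberTheory.EllipticCurves.QuadraticTwistJInvariantProofs
import Literature.NumberTheory.EllipticCurves.GlobalMinimalModelProofs
import Literature.NumberTheory.EllipticCurves.MazurRubin2010.TwistSelmerRankLowering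
import Literature.NumberTheory.EllipticCurves.ExceptionalPrimesDensityModels
import HarnessLib

/-!
# Route `GenusKolyvaginAtTwo`, crux #2 `GenusPrimitiveSupplyAtTwo` (stmt-BirchSwinnertonDyer-22136):
# MAZUR–RUBIN 2010 PROP. 5.2 OVER `ℚ` AS PRINTED (`E(ℚ)[2] = 0`, any model) from the two standard duality facts —
# `MazurRubin2010.prop52_rat ⟸ {Poitou–Tate (real places), Tate χ}`

Lead seat `bsd-line-gk2-p1` g8 (cell `bsd-f1-sign2`). THEOREMS ONLY (no definition, no named fact, no `sorry`); helper
`--supports stmt-BirchSwinnertonDyer-22136`; no item is closed; BSD is not proved by any of this.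

`…LoweringStep.prop52_of_hasSurjectiveModNGaloisRep` proves Prop. 5.2 for `ρ̄_{E,2}` onto. The printed proposition — and the tree's
named fact `MazurRubin2010.prop52_rat` (route item 24950 `MazurRubinProp52Rat`), consumed by name in `…TwinSupplyPrint`,
`…OfKernels[Closed]`, `…OfExactComponent`, `…OfExistsKernel` — assumes only `E(ℚ)[2] = 0` (image `C₃` or `S₃`) and any model. With
the image algebra of `…LoweringImageNoTwoTorsion` / `…LoweringPrimeNoTwoTorsion` this file proves it in that generality:

* `exists_prime_card_selmerGroup_quadraticTwist_mul_four_eq'` — the lowering prime for `W` globally minimal with no non-zero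
  `Γ_ℚ`-fixed point of `E[2]` (proof = `…LoweringStep` §2 verbatim, `hsurj ↦ hnt`);
* `prop52_of_forall_geomTorsion_eq_zero` — `W` globally minimal, `E[2]^{Γ_ℚ} = 0`, `#Sel₂(W) = 2^s`, `s > 1`, `m ≠ 0` ⟹
  `∃ p ≡ 1 (mod m)` prime, `#Sel₂(W^{(p)}) = 2^{s−2}`; `forall_geomTorsion_eq_zero_smul` (model independence of `E[2]^{Γ_ℚ} = 0`);
* **`prop52_rat_of_duality : poitouTate_selmerStructure_duality_real ℚ → (∀ v, localEulerPoincareCharacteristic ℚ_v) →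
  MazurRubin2010.prop52_rat`** — the named fact VERBATIM (any elliptic model: pass to a global minimal model `C • W`
  (`hasGlobalMinimalModel_rat_holds`), `E[2]^{Γ_ℚ} = 0` from `#W(ℚ)[2] = 1` and its model independence, `#Sel₂(C • W) = #Sel₂(W)`,
  `(C • W)^{(p)} ≅ W^{(p)}` (`quadraticTwist_smul`, `natCard_selmerGroup_smul`)). So every consumer of `prop52_rat` may write
  `prop52_rat_of_duality hPT hEP` for it: the print input «Mazur–Rubin 2010 Prop. 5.2» of the cell reduces to Milne ADT I.4.10 +
  Tate's local Euler characteristic.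

References: [MazurRubin2010] arXiv:0904.3709: Prop. 5.2 (p. 12), Lemma 3.6 (p. 9), Cor. 3.4 (i); [MilneADT2006] I Thm. 2.8, 4.10;
[SilvermanAEC2009] VIII.8 Cor. 8.3 (global minimal models over `ℚ`), X.§4.
-/

set_option linter.dupNamespace false -- tree convention: `Summit.BirchSwinnertonDyer.BirchSwinnertonDyer.Theorems` (summit = sub-problem)
set_option autoImplicit false

noncomputable section

open scoped Classical ContRepresentation AddSubgroup

namespace Summit.BirchSwinnertonDyer.BirchSwinnertonDyer.Theorems.GenusKolyLowering

open WeierstrassCurve Field NumberField IsDedekindDomain Function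
open Literature.NumberTheory.EllipticCurves Literature.NumberTheory.GaloisRepresentations
open Literature.NumberTheory.GaloisCohomology Literature.NumberTheory
open Rat.HeightOneSpectrum
open Summit.BirchSwinnertonDyer.BirchSwinnertonDyer.Theorems.GenusKolyTwistingPrime (primesEquiv_eq natCast_not_mem_of_not_dvd)
open Summit.BirchSwinnertonDyer.BirchSwinnertonDyer.Theorems.GenusKolyTwistRamified
  (valuation_natCast_eq_exp_neg_one_of_mem exists_uniformizer_sq_mul_of_valuation_eq)

/-! ## §5 The lowering prime under `E(ℚ)[2] = 0` -/

section Step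

variable (W : WeierstrassCurve ℚ) [W.IsElliptic] [W.IsGloballyMinimal]

/-- **THE LOWERING STEP (Prop. 5.2, Selmer form) under `E(ℚ)[2] = 0`, modulo {PT, Tate χ}** — as
`exists_prime_card_selmerGroup_quadraticTwist_mul_four_eq` with «`ρ̄₂` onto» replaced by «no non-zero `Γ_ℚ`-fixed point of `E[2]`».
[cite: MazurRubin2010, Prop. 5.2 and its proof (arXiv:0904.3709 p. 12), Cor. 3.4 (i), Lemma 3.6]
[cite: MilneADT2006, Ch. I, Thm. 4.10] [cite: SilvermanAEC2009, VII.5 Prop. 5.1(a)] -/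
theorem exists_prime_card_selmerGroup_quadraticTwist_mul_four_eq'
    (hPT : poitouTate_selmerStructure_duality_real ℚ)
    (hEP : ∀ v : HeightOneSpectrum (𝓞 ℚ), localEulerPoincareCharacteristic (v.adicCompletion ℚ))
    (hnt : ∀ P : geomTorsion W (2 : ℤ), (∀ σ : absoluteGaloisGroup ℚ, σ • P = P) → P = 0)
    {x y : galH1Torsion W (2 : ℤ)} (hxS : x ∈ W.selmerGroup 2) (hyS : y ∈ W.selmerGroup 2)
    (hx : x ≠ 0) (hy : y ≠ 0) (hxy : x ≠ y) {m : ℕ} (hm : m ≠ 0) :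
    ∃ p : ℕ, p.Prime ∧ (p : ℤ) ≡ 1 [ZMOD (m : ℤ)] ∧ ¬ p ∣ 2 * m ∧
      (∀ _h : Fact p.Prime, W.HasGoodReductionAtPrime p) ∧
      Nat.card ((W.quadraticTwist (p : ℚ)).selmerGroup 2) * 4 = Nat.card (W.selmerGroup 2) := by
  classical
  -- ### the finite set of bad places and the place of `2`
  have hbadfin : {v : HeightOneSpectrum (𝓞 ℚ) | ¬ W.HasGoodReductionAt v}.Finite := by
    have h := W.eventually_hasGoodReductionAt
    rwa [Filter.eventually_cofinite] at h
  have h2fin : {v : HeightOneSpectrum (𝓞 ℚ) | ((2 : ℕ) : 𝓞 ℚ) ∈ v.asIdeal}.Finite :=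
    Set.Subsingleton.finite fun v hv v' hv' ↦ HeightOneSpectrum.eq_of_natCast_mem_rat Nat.prime_two hv hv'
  set S' : Set (HeightOneSpectrum (𝓞 ℚ)) :=
    {v | ¬ W.HasGoodReductionAt v} ∪ {v | ((2 : ℕ) : 𝓞 ℚ) ∈ v.asIdeal} with hS'
  have hS'fin : S'.Finite := hbadfin.union h2fin
  -- ### the modulus `8 · m · ∏_{q bad} q`
  set Bad : Finset ℕ := hbadfin.toFinset.image (fun v ↦ (primesEquiv v : ℕ)) with hBad
  set M : ℕ := ∏ q ∈ Bad, q with hM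
  have hM0 : M ≠ 0 := Finset.prod_ne_zero_iff.mpr fun q hq ↦ by
    obtain ⟨v, -, rfl⟩ := Finset.mem_image.mp hq
    exact (primesEquiv v).2.ne_zero
  set m₀ : ℕ := 8 * m * M with hm₀
  have hm₀0 : m₀ ≠ 0 := mul_ne_zero (mul_ne_zero (by norm_num) hm) hM0
  -- ### the split twisting prime
  obtain ⟨p, hpF, -, hpm₀, hmod, v, 𝔓, t, hvS', hpv, -, -, -, -, -, -, -, -, hxloc, hyloc, hxyloc, hsubloc⟩ :=
    exists_splitTwistingPrime_pair' W hnt hx hy hxy ⊤ (by simp) (fun _ _ ↦ Subgroup.mem_top _)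
      hm₀0 ∅ hS'fin
  have hp : p.Prime := hpF.out
  have hgood : W.HasGoodReductionAt v := by
    by_contra h; exact hvS' (Or.inl h)
  have h2v : ((2 : ℕ) : 𝓞 ℚ) ∉ v.asIdeal := fun h ↦ hvS' (Or.inr h)
  have hp2 : p ≠ 2 := by rintro rfl; exact h2v hpv
  -- congruences extracted from `p ≡ 1 (mod 8 m M)`
  have hmod8 : (p : ℤ) % 8 = 1 := by
    have h := hmod.of_dvd (show ((8 : ℕ) : ℤ) ∣ (m₀ : ℤ) by
      rw [hm₀]; exact_mod_cast (dvd_mul_right 8 m).mul_right M)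
    have h' := Int.ModEq.eq h
    norm_num at h'
    omega
  have hmodm : (p : ℤ) ≡ 1 [ZMOD (m : ℤ)] :=
    hmod.of_dvd (by rw [hm₀]; exact_mod_cast (dvd_mul_left m 8).mul_right M)
  have hmodq : ∀ q ∈ Bad, (p : ℤ) ≡ 1 [ZMOD (q : ℤ)] := fun q hq ↦
    hmod.of_dvd (by rw [hm₀]; exact_mod_cast (Finset.dvd_prod_of_mem _ hq).mul_left (8 * m))
  have hpm : ¬ p ∣ 2 * m := fun h ↦ hpm₀ (by rw [hm₀, show 8 * m * M = 2 * m * (4 * M) by ring]; exact h.mul_right _)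
  -- ### the twist and its good reduction away from `2 p Δ`
  have hp0 : (p : ℚ) ≠ 0 := by exact_mod_cast hp.ne_zero
  haveI := W.isElliptic_quadraticTwist hp0
  have hΔ : ∀ (q : ℕ) [Fact q.Prime] (w : HeightOneSpectrum (𝓞 ℚ)), (q : 𝓞 ℚ) ∈ w.asIdeal →
      W.HasGoodReductionAt w → ¬ (q : ℤ) ∣ minimalDiscriminantInt W := fun q _ w hqw hw ↦
    W.not_dvd_minimalDiscriminantInt_of_hasGoodReductionAtPrime q
      (W.hasGoodReductionAtPrime_of_hasGoodReductionAt w hqw hw)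
  -- ### the Selmer count
  have hcount := natCard_selmerGroup_twist_mul_four_eq_of_places W hPT hEP hp0 (Wd := W.quadraticTwist (p : ℚ))
    (C := 1) (one_smul _ _) v h2v hgood
    (exists_uniformizer_sq_mul_of_valuation_eq v (valuation_natCast_eq_exp_neg_one_of_mem v hp hpv)) ?_ ?_ ?_
  · refine ⟨p, hp, hmodm, hpm, fun _ ↦ W.hasGoodReductionAtPrime_of_hasGoodReductionAt v hpv hgood, ?_⟩
    exact hcount
  · -- finite places `w ≠ v`
    intro w hw
    by_cases h2w : ((2 : ℕ) : 𝓞 ℚ) ∈ w.asIdeal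
    · exact Or.inl (exists_sq_eq_adicCompletion_of_mod_eight w h2w hmod8)
    by_cases hbad : W.HasGoodReductionAt w
    · -- good odd place `≠ v`: both curves good
      refine Or.inr (Or.inl ⟨h2w, hbad, ?_⟩)
      haveI hF : Fact (primesEquiv w : ℕ).Prime := ⟨(primesEquiv w).2⟩
      have hqw : ((primesEquiv w : ℕ) : 𝓞 ℚ) ∈ w.asIdeal := by
        have h := (natGenerator_dvd_iff (R := 𝓞 ℚ) w (n := (primesEquiv w : ℕ))).mp dvd_rfl
        rw [Ideal.mem_map_iff_of_surjective _ (Rat.IsIntegralClosure.intEquiv (𝓞 ℚ)).surjective] at h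
        obtain ⟨z, hz, hzq⟩ := h
        have : z = ((primesEquiv w : ℕ) : 𝓞 ℚ) :=
          (Rat.IsIntegralClosure.intEquiv (𝓞 ℚ)).injective (by rw [hzq, map_natCast])
        rwa [this] at hz
      have hq2 : (primesEquiv w : ℕ) ≠ 2 := fun h ↦ h2w (by rw [← h]; exact hqw)
      have hqp : (primesEquiv w : ℕ) ≠ p := fun h ↦ hw
        (HeightOneSpectrum.eq_of_natCast_mem_rat hp (by rw [← h]; exact hqw) hpv)
      have hpd : ¬ ((primesEquiv w : ℕ) : ℤ) ∣ 2 * (p : ℤ) := by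
        intro h
        have h' : (primesEquiv w : ℕ) ∣ 2 * p := by exact_mod_cast h
        rcases (Nat.Prime.dvd_mul hF.out).mp h' with h2 | hpp
        · exact hq2 ((Nat.prime_dvd_prime_iff_eq hF.out Nat.prime_two).mp h2)
        · exact hqp ((Nat.prime_dvd_prime_iff_eq hF.out hp).mp hpp)
      have h := W.hasGoodReductionAt_quadraticTwist w hpd (hΔ _ w hqw hbad)
      rwa [Int.cast_natCast] at h
    · -- bad place: `p ≡ 1 (mod q)` splits
      haveI hF : Fact (primesEquiv w : ℕ).Prime := ⟨(primesEquiv w).2⟩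
      have hqw : ((primesEquiv w : ℕ) : 𝓞 ℚ) ∈ w.asIdeal := by
        have h := (natGenerator_dvd_iff (R := 𝓞 ℚ) w (n := (primesEquiv w : ℕ))).mp dvd_rfl
        rw [Ideal.mem_map_iff_of_surjective _ (Rat.IsIntegralClosure.intEquiv (𝓞 ℚ)).surjective] at h
        obtain ⟨z, hz, hzq⟩ := h
        have : z = ((primesEquiv w : ℕ) : 𝓞 ℚ) :=
          (Rat.IsIntegralClosure.intEquiv (𝓞 ℚ)).injective (by rw [hzq, map_natCast])
        rwa [this] at hz
      have hq2 : (primesEquiv w : ℕ) ≠ 2 := fun h ↦ h2w (by rw [← h]; exact hqw)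
      have hqBad : (primesEquiv w : ℕ) ∈ Bad := Finset.mem_image.mpr ⟨w, hbadfin.mem_toFinset.mpr hbad, rfl⟩
      exact Or.inl (exists_sq_eq_adicCompletion_of_modEq_one w hF.out hq2 hqw (hmodq _ hqBad))
  · -- the infinite place splits (`p > 0`)
    exact fun w ↦ Or.inl (exists_sq_eq_infinitePlace_completion w p)
  · -- the two classes, in the Selmer-structure currency
    have hres : ∀ z : galH1Torsion W ((2 : ℕ) : ℤ), z ∉ W.torsionLocalKer (v.adicCompletion ℚ) ((2 : ℕ) : ℤ) →
        galoisCohomology.localization (W.torsionGaloisModule ((2 : ℕ) : ℤ)) (Sum.inr v) 1 z ≠ 0 := fun z hz h ↦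
      hz ((GenusKolyTwistLocal.mem_torsionLocalKer_iff_localization_eq_zero_rat W v z).mpr h)
    refine ⟨x, ?_, y, ?_, hres x hxloc, hres y hyloc, ?_, hres (x + y) hxyloc⟩
    · rw [← selmerGroup_eq_selmerGroup_kummerSelmerStructure]; exact hxS
    · rw [← selmerGroup_eq_selmerGroup_kummerSelmerStructure]; exact hyS
    · intro h
      exact hres (x - y) hsubloc
        ((map_sub (galoisCohomology.localization (W.torsionGaloisModule ((2 : ℕ) : ℤ)) (Sum.inr v) 1) x y).trans
          (sub_eq_zero.mpr h))


end Step

/-! ## §6 Prop. 5.2 as printed: `E(ℚ)[2] = 0`, any model -/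

section Prop52

/-- **Prop. 5.2 for a globally minimal `W/ℚ` whose `E[2]` has no non-zero `Γ_ℚ`-fixed point**, modulo {PT, Tate χ}.
[cite: MazurRubin2010, Prop. 5.2 and its proof (arXiv:0904.3709 p. 12) with Lemma 3.6 (p. 9)] -/
theorem prop52_of_forall_geomTorsion_eq_zero
    (hPT : poitouTate_selmerStructure_duality_real ℚ)
    (hEP : ∀ v : HeightOneSpectrum (𝓞 ℚ), localEulerPoincareCharacteristic (v.adicCompletion ℚ))
    (W : WeierstrassCurve ℚ) [W.IsElliptic] [W.IsGloballyMinimal]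
    (hnt : ∀ P : geomTorsion W (2 : ℤ), (∀ σ : absoluteGaloisGroup ℚ, σ • P = P) → P = 0)
    (s : ℕ) (hSel : Nat.card (W.selmerGroup 2) = 2 ^ s) (hs : 1 < s) (m : ℕ) (hm : m ≠ 0) :
    ∃ p : ℕ, p.Prime ∧ (p : ℤ) ≡ 1 [ZMOD (m : ℤ)] ∧
      Nat.card ((W.quadraticTwist (p : ℚ)).selmerGroup 2) = 2 ^ (s - 2) := by
  have h3 : 3 ≤ Nat.card (W.selmerGroup (2 : ℤ)) := by
    rw [hSel]
    calc 3 ≤ 2 ^ 2 := by norm_num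
      _ ≤ 2 ^ s := Nat.pow_le_pow_right (by norm_num) hs
  obtain ⟨x, hxS, y, hyS, hx, hy, hxy⟩ := exists_ne_ne_of_three_le_natCard (W.selmerGroup (2 : ℤ)) h3
  obtain ⟨p, hp, hmod, -, -, hcount⟩ :=
    exists_prime_card_selmerGroup_quadraticTwist_mul_four_eq' W hPT hEP hnt hxS hyS hx hy hxy hm
  refine ⟨p, hp, hmod, ?_⟩
  have hpow : 2 ^ s = 2 ^ (s - 2) * 4 := by
    have hs2 : 2 ≤ s := hs
    rw [show (4 : ℕ) = 2 ^ 2 by norm_num, ← pow_add, Nat.sub_add_cancel hs2]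
  rw [hSel, hpow] at hcount
  exact Nat.eq_of_mul_eq_mul_right (by norm_num) hcount

/-- **No non-zero `Γ_ℚ`-fixed `2`-torsion is model-independent** (`Γ_ℚ`-equivariant `W[n] ≃ (C • W)[n]`, tree
`exists_geomTorsion_addEquiv_smul`). [cite: SilvermanAEC2009, III.3.1(b)] -/
theorem forall_geomTorsion_eq_zero_smul (W : WeierstrassCurve ℚ) (C : VariableChange ℚ)
    (hnt : ∀ P : geomTorsion W (2 : ℤ), (∀ σ : absoluteGaloisGroup ℚ, σ • P = P) → P = 0) :
    ∀ P : geomTorsion (C • W) (2 : ℤ), (∀ σ : absoluteGaloisGroup ℚ, σ • P = P) → P = 0 := by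
  obtain ⟨e, he⟩ := exists_geomTorsion_addEquiv_smul W C (2 : ℤ)
  intro P hP
  have h0 : e.symm P = 0 := hnt (e.symm P) fun σ ↦ e.injective (by rw [he, e.apply_symm_apply, hP σ])
  have := congrArg e h0
  rwa [e.apply_symm_apply, map_zero] at this

/-- **`MazurRubin2010.prop52_rat` FROM THE TWO STANDARD DUALITY FACTS.** Mazur–Rubin 2010 Prop. 5.2 over `ℚ`, VERBATIM as the
tree's named fact (any elliptic model `W` with `#W(ℚ)[2] = 1`, `#Sel₂(W) = 2^s`, `s > 1`, modulus `m ≠ 0` ⟹ a prime `p ≡ 1 (mod m)`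
with `#Sel₂(W^{(p)}) = 2^{s−2}`), granted `poitouTate_selmerStructure_duality_real ℚ` (Milne ADT I.4.10 with real places) and
`localEulerPoincareCharacteristic` (Tate). Reduction to a global minimal model `C • W` (`hasGlobalMinimalModel_rat_holds`): the
hypothesis `#W(ℚ)[2] = 1` becomes «no non-zero `Γ_ℚ`-fixed point of `E[2]`» (`forall_geomTorsion_two_eq_zero_of_natCard_torsionBy_eq_one`),
which is model-independent (`forall_geomTorsion_eq_zero_smul`); `#Sel₂(C • W) = #Sel₂(W)` and `#Sel₂((C • W)^{(p)}) = #Sel₂(W^{(p)})`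
(`quadraticTwist_smul`, `natCard_selmerGroup_smul`); then `prop52_of_forall_geomTorsion_eq_zero` (= Lemma 3.6 + Čebotarev + the
index-4 transfer + Lemma 2.11 + the `d = +p` place menu). Consumers of the named fact (route item 24950 `MazurRubinProp52Rat`;
`…TwinSupplyPrint`, `…OfKernels[Closed]`, `…OfExactComponent`, `…OfExistsKernel`) may substitute `prop52_rat_of_duality hPT hEP`.
[cite: MazurRubin2010, Prop. 5.2 and its proof (arXiv:0904.3709 p. 12) with Lemma 3.6 (p. 9)]
[cite: MilneADT2006, Ch. I, Thm. 4.10] [cite: SilvermanAEC2009, VIII.8 Cor. 8.3] -/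
theorem prop52_rat_of_duality
    (hPT : poitouTate_selmerStructure_duality_real ℚ)
    (hEP : ∀ v : HeightOneSpectrum (𝓞 ℚ), localEulerPoincareCharacteristic (v.adicCompletion ℚ)) :
    MazurRubin2010.prop52_rat := by
  intro W _ htors s hSel hs m hm
  have hnt := forall_geomTorsion_two_eq_zero_of_natCard_torsionBy_eq_one W htors
  obtain ⟨C, hC⟩ := hasGlobalMinimalModel_rat_holds W
  haveI := hC
  have hnt' := forall_geomTorsion_eq_zero_smul W C hnt
  have hSel' : Nat.card ((C • W).selmerGroup 2) = 2 ^ s := by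
    have h := natCard_selmerGroup_smul W C two_ne_zero
    rw [Nat.cast_ofNat] at h
    rw [h]; exact hSel
  obtain ⟨p, hp, hmod, hcount⟩ := prop52_of_forall_geomTorsion_eq_zero hPT hEP (C • W) hnt' s hSel' hs m hm
  refine ⟨p, hp, hmod, ?_⟩
  have hp0 : (p : ℚ) ≠ 0 := by exact_mod_cast hp.ne_zero
  haveI := W.isElliptic_quadraticTwist hp0
  rw [quadraticTwist_smul W C (p : ℚ)] at hcount
  have h := natCard_selmerGroup_smul (W.quadraticTwist (p : ℚ)) (⟨C.u, (p : ℚ) * C.r, 0, 0⟩ : VariableChange ℚ) two_ne_zero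
  rw [Nat.cast_ofNat] at h
  rw [h] at hcount
  exact hcount

end Prop52

end Summit.BirchSwinnertonDyer.BirchSwinnertonDyer.Theorems.GenusKolyLowering

end
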